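import Summits.QuantumFields.QCD.Theses.AnomalyRigidity
import Summits.QuantumFields.QCD.Theses.HeatSlicedQuarks
import Summits.QuantumFields.QCD.Theses.GradientFlowSpecies

/-!
# Birth skeleton — crux `AnomalousWardTriple` (stmt-QuantumFields-17716), route `AnomalyRigidity` of `QuantumFields/QCD`

BC3 birth certificate (skeleton registrar, 2026-08-17): four NAMED stubs `stub_*` (the only `sorry`s of the file)
and the kernel-checked composition `AnomalousWardTriple_of : <stub₁> → <stub₂> → <stub₃> → <stub₄> →
Summit.QuantumFields.QCD.Theses.AnomalyRigidity.AnomalousWardTriple` (the crux BY NAME, no `sorry`).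

## The cut (heavy / light / anomaly, glued at THE PIN)

The crux is `∀ N_f ∈ {2,3}, ∃ reg, HasMassScaling ∧ (a) the gapped QCDOf body at every positive tuple ∧ (b) the
centred anomalous Ward triple on the degenerate ray m ∈ (0,1]`.  Both halves must hold for ONE regularisation, and (b)
(mass-independent weights, Ward germ `κ·m·Γ^P`) pins that regularisation's flavour-blind critical mass to the chiral
point.  The skeleton therefore builds the witness as the `m_crit`-SHIFT of an X₀-honest regularisation `reg` to the
infimum `P := sInf (gappedOffsets reg)` of the offsets above which every tuple is lattice-gapped (the "pin" of the
sibling crux 8892's lines `lee_yang_mass_handover` / `pin_the_infimum`, whose vocabulary §0 copies verbatim):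

* `stub_continuumQCDExists` = item stmt-QuantumFields-8870 `HeatSlicedQuarks.ContinuumQCDExists` BY NAME (X₀: for
  N_f = 2, 3 one mass-scaling regularisation with honest continuum QCD data at every positive tuple — UV construction,
  OS packaging, non-triviality, dynamical quarks; no gap, no chirality).  Target-sized, shared by every QCD route.
* `stub_massiveLatticeGap` = item stmt-QuantumFields-8922 `GradientFlowSpecies.MassiveLatticeGap` BY NAME (the
  heavy-threshold lattice half: above some offset every tuple of an X₀-honest regularisation is lattice-gapped), which
  makes `gappedOffsets reg` non-empty so that the pin is meaningful.  Yang–Mills-grade, open.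
* `stub_pinnedGappedBody` — LIGHT-QUARK COMPLETION: the regularisation shifted to the pin carries the full gapped body
  (a) at EVERY positive tuple (continuum data below X₀'s own offset, continuum gap from the lattice gap, one Δ(m) > 0 for
  both gap clauses).  = `stub_pinnedData` + `stub_latticeToSpeciesCS` (+ the definitional lattice gap above the pin) of
  `lee_yang_mass_handover` gen 5.1; crux-sized (the light window is X₀ again on the masses X₀'s witness may skip).
* `stub_wardTripleAtPin` — THE ANOMALY: part (b) of the crux VERBATIM (`WardTripleDataCentered`, the crux text with
  `reg` free) at the pinned regularisation: local lattice observables `V_μ, A_λ, P`, MASS-INDEPENDENT weights,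
  convergent torus transforms, `B₄` pseudo-covariance, bi-transversality, differentiability at zero momentum, the
  anomalous Ward germ `(p+q)·Γ_m − κ m Γ^P_m − c·ε(p,q) = o(|k|²)` with `c ≠ 0`, m-uniform local moments, m-uniform
  truncated reflected pair bounds, centring.  Same signature as `lee_yang_mass_handover.stub_wardTripleAtPin` (shared
  work).  Open physics: non-perturbative Karsten–Smit / Adler–Bardeen anomaly of Wilson fermions with the subtracted
  PCAC insertion controlled uniformly as m → 0⁺ [cite: KarstenSmit1981] [cite: BochicchioEtAl1985] [cite: FrewerRothe2001].

Composition (§2, sorry-free): for `N_f ∈ {2,3}` take X₀'s `reg`; 8922 gives `(gappedOffsets reg).Nonempty`; the pinned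
regularisation `shiftReg reg P` keeps `HasMassScaling` (`Z_m`, `a` untouched — definitional), stub 3 supplies (a), stub 4
supplies (b); these are the three conjuncts of the crux for that witness.

Not used here (left to crux-plan): the route header's Two-layer plan `LightChiralFamily → AnomalyNonRenormalisation`
(the triple with SOME `c`, then `c = c_free ≠ 0` by lattice Adler–Bardeen) — an alternative cut of `stub_wardTripleAtPin`
that needs the current-NORMALISATION vocabulary (exact vector Ward identity with insertions; "Not here" in
`Literature/…/QCDCurrentSector.lean`) before `c ≠ 0` can be typed without a degenerate (zero-weight) loophole.
Disproof used: none (the crux has no `Disproof.lean` yet, `ledger crux ls` 2026-08-17T04:5xZ); negatives index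
(5 entries) unrelated.
-/

namespace Summit.QuantumFields.QCD.Cruxes.AnomalousWardTriple.Birth

-- the `open` context of the route file `Theses/AnomalyRigidity.lean`, so that the copied crux text elaborates identically
open scoped BigOperators Topology Manifold Classical MeasureTheory ProbabilityTheory Matrix InnerProductSpace ComplexConjugate ContinuousMap
open Filter Set Function TopologicalSpace MeasureTheory

open Summit.QuantumFields.QCD.Theses.AnomalyRigidity
open Literature.MathematicalPhysics.QuantumFieldTheory

noncomputable section

variable {Nf : ℕ}

/-! ## §0 Skeleton-local definitions (the pin vocabulary of `Cruxes/RobustYangMillsHandover/Lines/lee_yang_mass_handover.lean`, verbatim) -/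

/-- The lattice theory of `reg` at the offset tuple `t` is gapped at SOME positive uniform rate. [folklore] -/
def LatticeGappedAt (reg : QCDRegularisation Nf) (t : Fin Nf → ℝ) : Prop :=
  ∃ Δ > (0 : ℝ), (reg.scheme t 0 0).HasLatticeMassGap Δ

/-- Offsets `M` above which EVERY tuple is lattice-gapped (pointwise rates). An up-set. [folklore] -/
def gappedOffsets (reg : QCDRegularisation Nf) : Set ℝ :=
  {M | ∀ t : Fin Nf → ℝ, (∀ f, M < t f) → LatticeGappedAt reg t}

/-- The `m_crit`-shift by the renormalised offset `M` (masses `m` of the shift are offsets `M + m` of `reg`). [folklore] -/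
def shiftReg (reg : QCDRegularisation Nf) (M : ℝ) : QCDRegularisation Nf :=
  { reg with mcrit := fun k => reg.mcrit k + reg.a k * M / reg.Zm k }

/-- X₀'s data for `reg`: honest continuum QCD at every positive mass tuple (no gap clauses) — the body of
`HeatSlicedQuarks.ContinuumQCDExists` for a GIVEN regularisation. [folklore] -/
def HonestDataAboveZero (reg : QCDRegularisation Nf) : Prop :=
  ∀ m : Fin Nf → ℝ, (∀ f, 0 < m f) →
    ∃ (z shift : QCDField Nf → ℕ → ℝ) (T : OSData (QCDField Nf) 4),
      IsQCDAlong (reg.scheme m z shift) T ∧ T.IsNontrivial QCDField.glue ∧ T.IsNonGaussian QCDField.glue ∧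
        ∀ f g : Fin Nf, f ≠ g → T.IsNontrivial (QCDField.pseudoRe f g)

/-- **Part (a) of the crux for a GIVEN regularisation** — the gapped `QCDOf` body at every positive tuple (honest
continuum data, the three non-triviality clauses, ONE `Δ(m) > 0` for `T.HasMassGap` and `HasLatticeMassGap`); the crux
text with `reg` free. [folklore] -/
def GappedBody (reg : QCDRegularisation Nf) : Prop :=
  open Literature.MathematicalPhysics.QuantumFieldTheory Literature.Probability.LatticeModels in ∀ m : Fin Nf → ℝ, (∀ f, 0 < m f) → ∃ z shift T, IsQCDAlong (reg.scheme m z shift) T ∧ T.IsNontrivial QCDField.glue ∧ T.IsNonGaussian QCDField.glue ∧ (∀ f g : Fin Nf, f ≠ g → T.IsNontrivial (QCDField.pseudoRe f g)) ∧ ∃ Δ > 0, T.HasMassGap Δ ∧ (reg.scheme m z shift).HasLatticeMassGap Δ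

/-- **Part (b) of the crux for a GIVEN regularisation** — centred anomalous Ward-triple data on the degenerate ray
`m ∈ (0, 1]`: the crux text with `reg` free (identical, after unfolding `Ev`, to
`LeeYangMassHandover.WardTripleDataCentered`). [cite: KarstenSmit1981] [cite: ColemanGrossman1982] -/
def WardTripleDataCentered (reg : QCDRegularisation Nf) : Prop :=
  open Literature.MathematicalPhysics.QuantumFieldTheory Literature.Probability.LatticeModels in ∃ (V A : Fin 4 → QCDLatticeObservable Nf 1) (P : QCDLatticeObservable Nf 1) (uV uA uP : ℕ → ℝ) (Γ : ℝ → (Fin 4 → ℝ) → (Fin 4 → ℝ) → Fin 4 → Fin 4 → Fin 4 → ℂ) (ΓP : ℝ → (Fin 4 → ℝ) → (Fin 4 → ℝ) → Fin 4 → Fin 4 → ℂ) (c : ℂ) (κ : ℝ), let ph := fun (k : ℕ) (x : Fin 4 → ℤ) (i : Fin 4) => reg.a k * (x i : ℝ); let E := fun (k S : ℕ) (m : ℝ) X => qcdTorusExpect (reg.β k) (2 * S + 1) (fun fl => (reg.scheme (fun _ => m) 0 0).mq fl k) X; let C3 := fun (k S : ℕ) (m : ℝ) (X Y Z : QCDLatticeObservable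 Nf 1) x y => E k S m (fun U => X.onTorus (2 * S + 1) x U * Y.onTorus (2 * S + 1) y U * Z.onTorus (2 * S + 1) 0 U); let F3 := fun (k S : ℕ) (m : ℝ) X Y Z (a b d : ℕ → ℝ) (p q : Fin 4 → ℝ) => ((reg.a k ^ 8 : ℝ) : ℂ) * ∑ x ∈ box 4 S, ∑ y ∈ box 4 S, Complex.exp (Complex.I * ((∑ i : Fin 4, (p i * ph k x i + q i * ph k y i) : ℝ) : ℂ)) * ((a k * b k * d k : ℝ) : ℂ) * C3 k S m X Y Z x y; let O := fun o : Option (Fin 4 ⊕ Unit) => Option.elim o (QCDLatticeObservable.one Nf 1) (Sum.elim V fun _ => P); let w := fun o : Option (Fin 4 ⊕ Unit) => Option.elim o (fun _ => (1 : ℝ)) (Sum.elim (fun _ => uV) fun _ => uP); let R2 := fun (S : ℕ) (X Y : QCDLatticeObservable Nf 1) x y U => Y.osAdjoint.onTorus (2 * S + 1) (siteReflect y) U * X.osAdjoint.onTorus (2 * S + 1) (siteReflect x) U; let P2 := fun (S : ℕ) (X Y : QCDLatticeObservable Nf 1) x y U => X.onTorus (2 * S + 1) x U * Y.onTorus (2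 * S + 1) y U; let V8 := (Fin 4 → ℝ) × (Fin 4 → ℝ); let q2 := fun k : V8 => ‖k‖ ^ 2; let Ev := fun (Q : ℕ → ℕ → Prop) => ∀ᶠ k in Filter.atTop, ∀ S, reg.L k ≤ S → Q k S; c ≠ 0 ∧ 0 < κ ∧ (∀ m : ℝ, 0 < m → m ≤ 1 → ((∀ p q μ ν la, ∀ δ : ℝ, 0 < δ → Ev fun k S => ‖F3 k S m (V μ) (V ν) (A la) uV uV uA p q - Γ m p q μ ν la‖ ≤ δ) ∧ (∀ p q μ ν, ∀ δ : ℝ, 0 < δ → Ev fun k S => ‖F3 k S m (V μ) (V ν) P uV uV uP p q - ΓP m p q μ ν‖ ≤ δ) ∧ (∀ R : Matrix (Fin 4) (Fin 4) ℝ, (∀ i j, R i j = 0 ∨ R i j = 1 ∨ R i j = -1) → R * R.transpose = 1 → ∀ (p q : (Fin 4 → ℝ)) μ ν la, Γ m (R.mulVec p) (R.mulVec q) μ ν la = ((R.det : ℝ) : ℂ) * ∑ μ', ∑ ν', ∑ la', ((R μ μ' * R ν ν' * R la la' : ℝ) : ℂ) * Γ m p q μ' ν' la') ∧ (∀ ν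 la, (fun k : V8 => ∑ μ : Fin 4, ((k.1 μ : ℝ) : ℂ) * Γ m k.1 k.2 μ ν la) =o[𝓝 0] q2) ∧ (∀ μ la, (fun k : V8 => ∑ ν : Fin 4, ((k.2 ν : ℝ) : ℂ) * Γ m k.1 k.2 μ ν la) =o[𝓝 0] q2) ∧ (∀ μ ν la, DifferentiableAt ℝ (fun k : V8 => Γ m k.1 k.2 μ ν la) 0) ∧ (∀ μ ν, (fun k : V8 => (∑ la : Fin 4, ((k.1 la + k.2 la : ℝ) : ℂ) * Γ m k.1 k.2 μ ν la) - ((κ * m : ℝ) : ℂ) * ΓP m k.1 k.2 μ ν - c * ((Matrix.det (Matrix.of ![Pi.single μ 1, Pi.single ν 1, k.1, k.2]) : ℝ) : ℂ)) =o[𝓝 0] q2))) ∧ (∀ Rl : ℝ, 0 < Rl → ∃ C : ℝ, ∀ m : ℝ, 0 < m → m ≤ 1 → ∀ (i j : ℕ), 1 ≤ i → i ≤ 2 → 1 ≤ j → j ≤ 2 → ∀ μ ν : Fin 4, Ev fun k S => (∑ x ∈ box 4 S, ∑ y ∈ box 4 S, if ‖ph k x‖ ≤ Rl ∧ ‖ph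 k y‖ ≤ Rl then reg.a k ^ 8 * ‖ph k x‖ ^ i * ‖ph k y‖ ^ j * ‖((uV k * uV k * uP k : ℝ) : ℂ) * C3 k S m (V μ) (V ν) P x y‖ else 0) ≤ C) ∧ (∃ σ : ℝ, σ < 4 ∧ ∀ τ : ℝ, 0 < τ → ∃ C : ℝ, ∀ m : ℝ, 0 < m → m ≤ 1 → ∀ ι₁ ι₂ : Option (Fin 4 ⊕ Unit), Ev fun k S => ∀ x ∈ box 4 S, ∀ y ∈ box 4 S, τ ≤ ph k x 0 → τ ≤ ph k y 0 → ‖ph k x‖ ≤ τ⁻¹ → ‖ph k y‖ ≤ τ⁻¹ → ‖(((w ι₁ k * w ι₂ k) ^ 2 : ℝ) : ℂ) * (E k S m (fun U => R2 S (O ι₁) (O ι₂) x y U * P2 S (O ι₁) (O ι₂) x y U) - E k S m (R2 S (O ι₁) (O ι₂) x y) * E k S m (P2 S (O ι₁) (O ι₂) x y))‖ ≤ C * (reg.a k + ‖ph k x - ph k y‖) ^ (-(2 * σ))) ∧ (∀ m : ℝ, 0 < m → m ≤ 1 → ∀ μ : Fin 4, Ev fun k S => ∀ x ∈ box 4 S,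 E k S m ((V μ).onTorus (2 * S + 1) x) = 0) ∧ (∀ m : ℝ, 0 < m → m ≤ 1 → Ev fun k S => ∀ x ∈ box 4 S, E k S m (P.onTorus (2 * S + 1) x) = 0)

/-- Signature of stub 3 (light-quark completion at the pin). -/
def PinnedGappedBody : Prop :=
  ∀ (Nf : ℕ), (Nf = 2 ∨ Nf = 3) → ∀ reg : QCDRegularisation Nf, reg.HasMassScaling →
    HonestDataAboveZero reg → (gappedOffsets reg).Nonempty →
      GappedBody (shiftReg reg (sInf (gappedOffsets reg)))

/-- Signature of stub 4 (the anomalous Ward triple at the pin). -/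
def WardTripleAtPin : Prop :=
  ∀ (Nf : ℕ), (Nf = 2 ∨ Nf = 3) → ∀ reg : QCDRegularisation Nf, reg.HasMassScaling →
    HonestDataAboveZero reg → (gappedOffsets reg).Nonempty →
      WardTripleDataCentered (shiftReg reg (sInf (gappedOffsets reg)))

/-! ## §1 The registered stubs (the only `sorry`s of the file) -/

/-- **stub_continuumQCDExists — X₀, BY NAME** (item stmt-QuantumFields-8870, `HeatSlicedQuarks.ContinuumQCDExists`,
target of route HeatSlicedQuarks, open): for `N_f = 2, 3` one mass-scaling regularisation with honest continuum QCD data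
(`IsQCDAlong`, non-trivial non-Gaussian glue, dynamical quarks) at every positive tuple.  Size: target. -/
theorem stub_continuumQCDExists : Summit.QuantumFields.QCD.Theses.HeatSlicedQuarks.ContinuumQCDExists := by
  sorry

/-- **stub_massiveLatticeGap — the heavy-threshold lattice half, BY NAME** (item stmt-QuantumFields-8922,
`GradientFlowSpecies.MassiveLatticeGap`, open): every X₀-honest regularisation has a threshold above which every tuple is
lattice-gapped at some rate (Yang–Mills lattice gap in physical units + heavy-quark decoupling).  Size XL. -/
theorem stub_massiveLatticeGap : Summit.QuantumFields.QCD.Theses.GradientFlowSpecies.MassiveLatticeGap := by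
  sorry

/-- **stub_pinnedGappedBody — light-quark completion at the pin**: for the regularisation X₀ hands over, with non-empty
gapped offsets, the regularisation shifted by the infimum of its gapped offsets carries the full gapped `QCDOf` body at
every positive tuple.  The lattice gap above the pin is definitional (`sInf`); the content is honest continuum data on
the window `(P, 0]` below X₀'s own offset, and the continuum gap of a lattice-gapped honest scheme (the `∃Δ` kernel of
item 8923).  Why plausibly true: the pin is the chiral point of `reg`'s bare family (the degenerate chiral tuple is
gapless, everything above it is massive QCD).  Size XL (crux-sized). [cite: JaffeWitten2000, §5] [cite: OsterwalderSeiler1978] -/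
theorem stub_pinnedGappedBody : PinnedGappedBody := by
  sorry

/-- **stub_wardTripleAtPin — the anomalous Ward triple of the PINNED regularisation** (part (b) of the crux at
`shiftReg reg (sInf (gappedOffsets reg))`; same signature as `LeeYangMassHandover.stub_wardTripleAtPin`): the pin is
the PCAC-critical point, so mass-independent weights and the germ `κ·m·Γ^P` are consistent there; `c ≠ 0` is the
non-perturbative Karsten–Smit / Adler–Bardeen anomaly of the conserved vector and local axial Wilson currents.  Why it
might fail: m-uniform control of the subtracted PCAC insertion and of the truncated reflected pair bounds as `m → 0⁺`.
Size XL (open physics). [cite: KarstenSmit1981] [cite: BochicchioEtAl1985] [cite: FrewerRothe2001] -/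
theorem stub_wardTripleAtPin : WardTripleAtPin := by
  sorry

/-! ## §2 Composition (sorry-free) -/

/-- The shift keeps `HasMassScaling` (which never reads `m_crit`). [folklore] -/
theorem shiftReg_hasMassScaling_iff (reg : QCDRegularisation Nf) (M : ℝ) :
    (shiftReg reg M).HasMassScaling ↔ reg.HasMassScaling :=
  Iff.rfl

/-- Non-emptiness of the gapped offsets of an X₀-honest regularisation, from the heavy half (8922). [folklore] -/
theorem gappedOffsets_nonempty (h : Summit.QuantumFields.QCD.Theses.GradientFlowSpecies.MassiveLatticeGap)
    (hNf : Nf = 2 ∨ Nf = 3) (reg : QCDRegularisation Nf) (hMS : reg.HasMassScaling)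
    (hX : HonestDataAboveZero reg) : (gappedOffsets reg).Nonempty := by
  obtain ⟨M, hM⟩ := h Nf hNf reg ⟨hMS, hX⟩
  exact ⟨M, fun t ht => hM t ht⟩

/-- **The crux for ONE flavour number from the pinned data** (pure logic: the three conjuncts of the crux for the
witness `shiftReg reg (sInf (gappedOffsets reg))`). [folklore] -/
theorem anomalousWardTriple_at (reg : QCDRegularisation Nf) (hMS : reg.HasMassScaling)
    (hbody : GappedBody (shiftReg reg (sInf (gappedOffsets reg))))
    (htrip : WardTripleDataCentered (shiftReg reg (sInf (gappedOffsets reg)))) :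
    ∃ reg' : QCDRegularisation Nf, reg'.HasMassScaling ∧ GappedBody reg' ∧ WardTripleDataCentered reg' :=
  ⟨shiftReg reg (sInf (gappedOffsets reg)), (shiftReg_hasMassScaling_iff reg _).mpr hMS, hbody, htrip⟩

/-- **The crux BY NAME from the four stubs' statements.** [folklore] -/
theorem AnomalousWardTriple_of :
    Summit.QuantumFields.QCD.Theses.HeatSlicedQuarks.ContinuumQCDExists →
    Summit.QuantumFields.QCD.Theses.GradientFlowSpecies.MassiveLatticeGap →
    PinnedGappedBody → WardTripleAtPin →
    Summit.QuantumFields.QCD.Theses.AnomalyRigidity.AnomalousWardTriple := by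
  intro hX hH hpin htrip Nf hNf
  obtain ⟨reg, hMS, hb⟩ := hX Nf hNf
  have hne : (gappedOffsets reg).Nonempty := gappedOffsets_nonempty hH hNf reg hMS hb
  obtain ⟨reg', hMS', hbody', htrip'⟩ :=
    anomalousWardTriple_at reg hMS (hpin Nf hNf reg hMS hb hne) (htrip Nf hNf reg hMS hb hne)
  exact ⟨reg', hMS', hbody', htrip'⟩

/-- The crux, closed by the stubs themselves (sanity instance of the composition). [folklore] -/
theorem anomalousWardTriple_of_stubs : Summit.QuantumFields.QCD.Theses.AnomalyRigidity.AnomalousWardTriple :=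
  AnomalousWardTriple_of stub_continuumQCDExists stub_massiveLatticeGap stub_pinnedGappedBody stub_wardTripleAtPin

end

end Summit.QuantumFields.QCD.Cruxes.AnomalousWardTriple.Birth
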